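import Literature.Topology.FourManifolds.HandleChartField
import HarnessLib

/-!
# The handle region of a handle chart and its invariance under the flow

Topic `Literature/Topology/FourManifolds` (fact seat
`provefact-Literature.Topology.FourManifolds.IsHandlebody.exists_isBoundaryGluing_sphere`, step F2b of
the Lickorish–Wallace DAG; region layer of the handle-extension step of the classification of
handlebodies).  Everything here is **proved**; no named facts.

Milnor, *Lectures on the h-cobordism theorem* (1965), proof of Thm. 3.13 (PDF p. 18), compares
a manifold with the union of its lower sublevel set and a neighbourhood of the handle bounded by
the level sets of `f` and by the hypersurface `L = {|x⃗|²|y⃗|² = const}` made of trajectories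
("the cell `H` bounded by `L`, the left-hand disc … is the required handle").  For a handle chart
`D` (`HandleChartField.lean`: `f = f p + Q_k(u)`, `dφ̂ X = Ê(u)`) with the closed ball of radius
`3ε` about `φ̂ p` in the chart target, the **handle region**
`D.region ε γ ℓ⁻ ℓ⁺ = {q ∈ φ.source | |x⃗|² < ε², |y⃗|² < 4ε², |x⃗|²|y⃗|² ≤ γ, ℓ⁻ ≤ f q ≤ ℓ⁺}`
is, when the levels `ℓ⁻, ℓ⁺` keep it off the walls of the box
(`f p - ε² + γ/ε² < ℓ⁻`, `ℓ⁺ < f p + 4ε² - γ/(4ε²)`):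

* compact (`isCompact_region`), contained in the open box, containing the core balls
  `{‖u‖ ≤ ρ}` of the slab for `ρ⁴ ≤ 4γ`, `ρ < ε` (`mem_region_of_norm_le`);
* **invariant**: along an orbit of a global flow of `X` whose levels stay in `[ℓ⁻, ℓ⁺]` during
  a time interval, membership in the region does not change
  (`IsFlowOf.mem_region_iff_of_forall_apply_mem`) — the region can only be entered or left
  through `{|x⃗|²|y⃗|² = γ}`, which the conservation of `|x⃗|²|y⃗|²` inside the chart forbids
  (`IsFlowOf.sqSumLT_mul_sqSumGE_eq_of_forall_mem`), or through the walls of the box, which the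
  level bounds exclude.

## References

* J. Milnor, *Lectures on the h-cobordism theorem* (1965), proofs of Thm. 3.12 and Thm. 3.13
  (PDF pp. 17–19). [MilnorHCobordism1965]
-/

open scoped Manifold ContDiff Topology
open Set Function Filter Metric

noncomputable section

namespace Literature.Topology.FourManifolds

universe u

variable {m : ℕ} {H : Type*} [TopologicalSpace H] {J : ModelWithCorners ℝ (EuclideanSpace ℝ (Fin m)) H}
  {M : Type u} [TopologicalSpace M] [ChartedSpace H M]

/-- Local notation: `𝔼 m` is the model Euclidean space `EuclideanSpace ℝ (Fin m)`. -/
local notation "𝔼 " m:arg => EuclideanSpace ℝ (Fin m)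

/-! ### Elementary inequalities in the model -/

/-- `|x⃗|²|y⃗|² ≤ ‖u‖⁴ / 4` (AM–GM with `|x⃗|² + |y⃗|² = ‖u‖²`). [folklore] -/
theorem sqSumLT_mul_sqSumGE_le (k : ℕ) (u : 𝔼 m) :
    sqSumLT k u * sqSumGE k u ≤ ‖u‖ ^ 4 / 4 := by
  have h := sqSumLT_add_sqSumGE (m := m) k u
  nlinarith [sq_nonneg (sqSumLT k u - sqSumGE k u)]

/-- `|x⃗|² ≤ ‖u‖²` and `|y⃗|² ≤ ‖u‖²`. [folklore] -/
theorem sqSumLT_le_norm_sq (k : ℕ) (u : 𝔼 m) : sqSumLT k u ≤ ‖u‖ ^ 2 := by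
  have h := sqSumLT_add_sqSumGE (m := m) k u
  linarith [sqSumGE_nonneg (m := m) k u]

/-- `|y⃗|² ≤ ‖u‖²`. [folklore] -/
theorem sqSumGE_le_norm_sq (k : ℕ) (u : 𝔼 m) : sqSumGE k u ≤ ‖u‖ ^ 2 := by
  have h := sqSumLT_add_sqSumGE (m := m) k u
  linarith [sqSumLT_nonneg (m := m) k u]

namespace HandleChart

variable {f : M → ℝ} {X : Π x : M, TangentSpace J x} {p : M} (D : HandleChart J f X p)

/-! ### The region -/

/-- **The handle region** `{q ∈ φ.source | |x⃗|² < ε², |y⃗|² < 4ε², |x⃗|²|y⃗|² ≤ γ, ℓ⁻ ≤ f q ≤ ℓ⁺}`: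
the part of the slab `f⁻¹[ℓ⁻, ℓ⁺]` inside Milnor's box within the hypersurface
`L = {|x⃗|²|y⃗|² = γ}` (Milnor 1965, proof of Thm. 3.13: the cell bounded by `L` and the
levels). [cite: MilnorHCobordism1965, proof of Thm. 3.13 (PDF p. 18)] -/
def region (ε γ ℓl ℓu : ℝ) : Set M :=
  {q | q ∈ D.chart.source ∧ sqSumLT D.k (D.coord q) < ε ^ 2 ∧ sqSumGE D.k (D.coord q) < 4 * ε ^ 2 ∧
    sqSumLT D.k (D.coord q) * sqSumGE D.k (D.coord q) ≤ γ ∧ f q ∈ Icc ℓl ℓu}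

variable {ε γ ℓl ℓu : ℝ}

/-- Points of the region lie in the chart domain. [folklore] -/
theorem mem_source_of_mem_region {q : M} (hq : q ∈ D.region ε γ ℓl ℓu) : q ∈ D.chart.source := hq.1

/-- On the chart domain, `f = f p - |x⃗|² + |y⃗|²`. [cite: MilnorHCobordism1965, Def. 3.1] -/
theorem apply_eq_sq {q : M} (hq : q ∈ D.chart.source) :
    f q = f p - sqSumLT D.k (D.coord q) + sqSumGE D.k (D.coord q) := by
  rw [D.apply_eq q hq, milnorQuadratic_eq]
  show f p + (-sqSumLT D.k (D.coord q) + sqSumGE D.k (D.coord q)) = _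
  ring

/-- **The region does not touch the walls of the box** (closed form): under the level bounds
`f p - ε² + γ/ε² < ℓ⁻` and `ℓ⁺ < f p + 4ε² - γ/(4ε²)`, a point of the chart domain with
`|x⃗|² ≤ ε²`, `|y⃗|² ≤ 4ε²`, `|x⃗|²|y⃗|² ≤ γ` and `f ∈ [ℓ⁻, ℓ⁺]` already has `|x⃗|² < ε²` and
`|y⃗|² < 4ε²`. [cite: MilnorHCobordism1965, proof of Thm. 3.13 (PDF p. 18)] -/
theorem sq_lt_of_le (hε : 0 < ε) (hlow : f p - ε ^ 2 + γ / ε ^ 2 < ℓl)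
    (hhigh : ℓu < f p + 4 * ε ^ 2 - γ / (4 * ε ^ 2)) {q : M} (hq : q ∈ D.chart.source)
    (hA : sqSumLT D.k (D.coord q) ≤ ε ^ 2) (hB : sqSumGE D.k (D.coord q) ≤ 4 * ε ^ 2)
    (hAB : sqSumLT D.k (D.coord q) * sqSumGE D.k (D.coord q) ≤ γ) (hf : f q ∈ Icc ℓl ℓu) :
    sqSumLT D.k (D.coord q) < ε ^ 2 ∧ sqSumGE D.k (D.coord q) < 4 * ε ^ 2 := by
  set A := sqSumLT D.k (D.coord q) with hA_def
  set B := sqSumGE D.k (D.coord q) with hB_def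
  have hA0 : 0 ≤ A := sqSumLT_nonneg _ _
  have hB0 : 0 ≤ B := sqSumGE_nonneg _ _
  have hfq := D.apply_eq_sq hq
  have hε2 : 0 < ε ^ 2 := by positivity
  constructor
  · by_contra hge
    have hAeq : A = ε ^ 2 := le_antisymm hA (not_lt.1 hge)
    -- `B ≤ γ / ε²`
    have hBle : B ≤ γ / ε ^ 2 := by
      rw [le_div_iff₀ hε2]; nlinarith
    have : f q ≤ f p - ε ^ 2 + γ / ε ^ 2 := by rw [hfq]; linarith
    linarith [hf.1]
  · by_contra hge
    have hBeq : B = 4 * ε ^ 2 := le_antisymm hB (not_lt.1 hge)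
    have h4 : 0 < 4 * ε ^ 2 := by positivity
    have hAle : A ≤ γ / (4 * ε ^ 2) := by
      rw [le_div_iff₀ h4]; nlinarith
    have : f p + 4 * ε ^ 2 - γ / (4 * ε ^ 2) ≤ f q := by rw [hfq]; linarith
    linarith [hf.2]

/-- **The region is compact** (when the closed ball of radius `3ε` about `φ̂ p` lies in the chart
target, `f` is continuous, and the level bounds keep the region off the walls): it is the image
under `φ̂⁻¹` of a closed bounded subset of the model. [cite: MilnorHCobordism1965, proof of Thm. 3.13 (PDF p. 18)] -/
theorem isCompact_region [T2Space M] (hfc : Continuous f) (hε : 0 < ε)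
    (hball : closedBall (D.chart.extend J p) (3 * ε) ⊆ (D.chart.extend J).target)
    (hlow : f p - ε ^ 2 + γ / ε ^ 2 < ℓl) (hhigh : ℓu < f p + 4 * ε ^ 2 - γ / (4 * ε ^ 2)) :
    IsCompact (D.region ε γ ℓl ℓu) := by
  set Φ := D.chart.extend J with hΦ
  set u₀ := Φ p with hu₀
  -- the model set
  set K : Set (𝔼 m) := {v | sqSumLT D.k v ≤ ε ^ 2 ∧ sqSumGE D.k v ≤ 4 * ε ^ 2 ∧
    sqSumLT D.k v * sqSumGE D.k v ≤ γ ∧ f (Φ.symm (u₀ + v)) ∈ Icc ℓl ℓu} with hK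
  have hKball : ∀ v ∈ K, u₀ + v ∈ closedBall u₀ (3 * ε) := by
    intro v hv
    rw [mem_closedBall, dist_eq_norm, add_sub_cancel_left]
    have h1 : ‖v‖ ^ 2 ≤ 5 * ε ^ 2 := by rw [← sqSumLT_add_sqSumGE D.k v]; linarith [hv.1, hv.2.1]
    nlinarith [norm_nonneg v, hε]
  have hKt : ∀ v ∈ K, u₀ + v ∈ Φ.target := fun v hv => hball (hKball v hv)
  -- continuity of the defining functions on the closed ball
  have hcontΦ : ContinuousOn (fun v : 𝔼 m => Φ.symm (u₀ + v)) {v | u₀ + v ∈ closedBall u₀ (3 * ε)} :=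
    ((D.chart.continuousOn_extend_symm (I := J)).mono hball).comp
      (continuous_const.add continuous_id).continuousOn fun v hv => hv
  have hKc : IsCompact K := by
    have hC : IsClosed {v : 𝔼 m | u₀ + v ∈ closedBall u₀ (3 * ε)} :=
      isClosed_closedBall.preimage (continuous_const.add continuous_id)
    have hcont : ContinuousOn (fun v : 𝔼 m =>
        (sqSumLT D.k v, sqSumGE D.k v, sqSumLT D.k v * sqSumGE D.k v, f (Φ.symm (u₀ + v))))
        {v : 𝔼 m | u₀ + v ∈ closedBall u₀ (3 * ε)} :=
      (continuous_sqSumLT D.k).continuousOn.prodMk ((continuous_sqSumGE D.k).continuousOn.prodMk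
        (((continuous_sqSumLT D.k).mul (continuous_sqSumGE D.k)).continuousOn.prodMk
          (hfc.comp_continuousOn hcontΦ)))
    have hclosed' := hcont.preimage_isClosed_of_isClosed hC
      (isClosed_Iic.prod (isClosed_Iic.prod (isClosed_Iic.prod isClosed_Icc)) :
        IsClosed (Iic (ε ^ 2) ×ˢ (Iic (4 * ε ^ 2) ×ˢ (Iic γ ×ˢ Icc ℓl ℓu))))
    have heq : {v : 𝔼 m | u₀ + v ∈ closedBall u₀ (3 * ε)} ∩
        (fun v : 𝔼 m => (sqSumLT D.k v, sqSumGE D.k v, sqSumLT D.k v * sqSumGE D.k v,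
          f (Φ.symm (u₀ + v)))) ⁻¹' (Iic (ε ^ 2) ×ˢ (Iic (4 * ε ^ 2) ×ˢ (Iic γ ×ˢ Icc ℓl ℓu))) = K := by
      ext v
      simp only [mem_inter_iff, mem_setOf_eq, mem_preimage, mem_prod, mem_Iic, K]
      exact ⟨fun h => h.2, fun h => ⟨hKball v h, h⟩⟩
    rw [heq] at hclosed'
    refine Metric.isCompact_of_isClosed_isBounded hclosed' ?_
    refine (isBounded_closedBall (x := (0 : 𝔼 m)) (r := 3 * ε)).subset fun v hv => ?_
    have := hKball v hv
    rw [mem_closedBall, dist_eq_norm, add_sub_cancel_left] at this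
    simpa using this
  -- the region is the image of `K`
  have himage : D.region ε γ ℓl ℓu = (fun v => Φ.symm (u₀ + v)) '' K := by
    ext q
    constructor
    · rintro ⟨hq, hA, hB, hAB, hfq⟩
      refine ⟨D.coord q, ⟨hA.le, hB.le, hAB, ?_⟩, ?_⟩
      · have : Φ.symm (u₀ + D.coord q) = q := by
          rw [coord, add_sub_cancel, Φ.left_inv (by rw [D.chart.extend_source]; exact hq)]
        rw [this]; exact hfq
      · show Φ.symm (u₀ + D.coord q) = q
        rw [coord, add_sub_cancel, Φ.left_inv (by rw [D.chart.extend_source]; exact hq)]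
    · rintro ⟨v, hv, rfl⟩
      have hvt := hKt v hv
      have hsrc : Φ.symm (u₀ + v) ∈ D.chart.source := by
        rw [← D.chart.extend_source (I := J)]; exact Φ.map_target hvt
      have hc : D.coord (Φ.symm (u₀ + v)) = v := by
        rw [coord, Φ.right_inv hvt, add_sub_cancel_left]
      have hlt := D.sq_lt_of_le hε hlow hhigh hsrc (by rw [hc]; exact hv.1) (by rw [hc]; exact hv.2.1)
        (by rw [hc]; exact hv.2.2.1) hv.2.2.2
      exact ⟨hsrc, hlt.1, hlt.2, by rw [hc]; exact hv.2.2.1, hv.2.2.2⟩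
  rw [himage]
  exact hKc.image_of_continuousOn (hcontΦ.mono fun v hv => hKball v hv)

/-- **Small core balls of the slab lie in the region**: if `ρ < ε`, `ρ⁴ ≤ 4γ`, then every point
of the chart domain with `‖u‖ ≤ ρ` and `f ∈ [ℓ⁻, ℓ⁺]` is in the region. [folklore] -/
theorem mem_region_of_norm_le {ρ : ℝ} (hρ : 0 ≤ ρ) (hρε : ρ < ε) (hργ : ρ ^ 4 ≤ 4 * γ) {q : M}
    (hq : q ∈ D.chart.source) (hu : ‖D.coord q‖ ≤ ρ) (hf : f q ∈ Icc ℓl ℓu) :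
    q ∈ D.region ε γ ℓl ℓu := by
  have h2 : ‖D.coord q‖ ^ 2 ≤ ρ ^ 2 := pow_le_pow_left₀ (norm_nonneg _) hu 2
  have h4 : ‖D.coord q‖ ^ 4 ≤ ρ ^ 4 := pow_le_pow_left₀ (norm_nonneg _) hu 4
  have hρ2 : ρ ^ 2 < ε ^ 2 := by nlinarith
  refine ⟨hq, ?_, ?_, ?_, hf⟩
  · exact (sqSumLT_le_norm_sq _ _).trans_lt (h2.trans_lt hρ2)
  · have := sqSumGE_le_norm_sq D.k (D.coord q)
    nlinarith [sq_nonneg ε]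
  · have := sqSumLT_mul_sqSumGE_le (m := m) D.k (D.coord q)
    linarith

/-- Points of the region are off the walls with room to spare: the region lies in the open set
`{q ∈ φ.source | |x⃗|² < ε², |y⃗|² < 4ε²}`. [folklore] -/
theorem region_subset_box : D.region ε γ ℓl ℓu ⊆
    {q | q ∈ D.chart.source ∧ sqSumLT D.k (D.coord q) < ε ^ 2 ∧ sqSumGE D.k (D.coord q) < 4 * ε ^ 2} :=
  fun _ hq => ⟨hq.1, hq.2.1, hq.2.2.1⟩

/-- The open box `{q ∈ φ.source | |x⃗|² < ε², |y⃗|² < 4ε²}` is open. [folklore] -/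
theorem isOpen_box :
    IsOpen {q | q ∈ D.chart.source ∧ sqSumLT D.k (D.coord q) < ε ^ 2 ∧ sqSumGE D.k (D.coord q) < 4 * ε ^ 2} := by
  have h1 : IsOpen {v : 𝔼 m | sqSumLT D.k v < ε ^ 2 ∧ sqSumGE D.k v < 4 * ε ^ 2} :=
    (isOpen_lt (continuous_sqSumLT D.k) continuous_const).inter
      (isOpen_lt (continuous_sqSumGE D.k) continuous_const)
  have h2 := D.continuousOn_coord.isOpen_inter_preimage D.chart.open_source h1
  convert h2 using 1
  ext q
  simp only [mem_setOf_eq, mem_inter_iff, mem_preimage]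

end HandleChart

/-! ### Invariance along the flow -/

section Invariance

variable {f : M → ℝ} {X : Π x : M, TangentSpace J x} {θ : ℝ × M → M} {p : M}
  {ε γ ℓl ℓu : ℝ}

/-- **Local invariance**: if the orbit point `θ(t, z)` lies in the region, then so do the orbit
points at all nearby times at which the level is in `[ℓ⁻, ℓ⁺]` — nearby points are in the open
box and the chart domain, and `|x⃗|²|y⃗|²` is conserved on the orbit segment between them.
[cite: MilnorHCobordism1965, proof of Thm. 3.13 (PDF p. 18)] -/
theorem IsFlowOf.eventually_mem_region (h : IsFlowOf J X θ) (D : HandleChart J f X p) {z : M} {t : ℝ}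
    (ht : θ (t, z) ∈ D.region ε γ ℓl ℓu) :
    ∀ᶠ s in 𝓝 t, f (θ (s, z)) ∈ Icc ℓl ℓu → θ (s, z) ∈ D.region ε γ ℓl ℓu := by
  -- times at which the orbit is in the open box
  have hopen : IsOpen {s : ℝ | θ (s, z) ∈ {q | q ∈ D.chart.source ∧ sqSumLT D.k (D.coord q) < ε ^ 2 ∧
      sqSumGE D.k (D.coord q) < 4 * ε ^ 2}} := D.isOpen_box.preimage (h.continuous_orbit z)
  obtain ⟨δ, hδ, hball⟩ := Metric.isOpen_iff.1 hopen t (D.region_subset_box ht)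
  filter_upwards [Metric.ball_mem_nhds t hδ] with s hs hfs
  have hs' := hball hs
  refine ⟨hs'.1, hs'.2.1, hs'.2.2, ?_, hfs⟩
  -- conservation on the segment between `t` and `s`
  have hseg : ∀ r ∈ Icc (min t s) (max t s), θ (r, z) ∈ D.chart.source := by
    intro r hr
    refine (hball ?_).1
    rw [Metric.mem_ball, Real.dist_eq]
    rw [Metric.mem_ball, Real.dist_eq] at hs
    rcases le_total t s with hts | hts
    · rw [min_eq_left hts, max_eq_right hts] at hr
      rw [abs_lt] at hs ⊢; constructor <;> linarith [hr.1, hr.2]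
    · rw [min_eq_right hts, max_eq_left hts] at hr
      rw [abs_lt] at hs ⊢; constructor <;> linarith [hr.1, hr.2]
  have h1 := h.sqSumLT_mul_sqSumGE_eq_of_forall_mem D hseg (t := s) ⟨min_le_right _ _, le_max_right _ _⟩
  have h2 := h.sqSumLT_mul_sqSumGE_eq_of_forall_mem D hseg (t := t) ⟨min_le_left _ _, le_max_left _ _⟩
  rw [h1, ← h2]
  exact ht.2.2.2.1

/-- **Invariance of the handle region along the flow**: if the levels of the orbit of `z` stay
in `[ℓ⁻, ℓ⁺]` during the time interval `[t₁, t₂]`, then the orbit is in the region at all times of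
the interval or at none (the region is closed, so the set of times in the region is closed; it is
open by `eventually_mem_region`; `[t₁, t₂]` is connected).  Milnor 1965, proof of Thm. 3.13: the
boundary piece `L` of the cell is a union of trajectories. [cite: MilnorHCobordism1965, proof of Thm. 3.13 (PDF p. 18)] -/
theorem IsFlowOf.mem_region_iff_of_forall_apply_mem (h : IsFlowOf J X θ) (D : HandleChart J f X p)
    (hN : IsClosed (D.region ε γ ℓl ℓu)) {z : M} {t₁ t₂ : ℝ}
    (hlev : ∀ t ∈ Icc t₁ t₂, f (θ (t, z)) ∈ Icc ℓl ℓu) {t t' : ℝ} (ht : t ∈ Icc t₁ t₂)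
    (ht' : t' ∈ Icc t₁ t₂) :
    θ (t, z) ∈ D.region ε γ ℓl ℓu ↔ θ (t', z) ∈ D.region ε γ ℓl ℓu := by
  haveI : PreconnectedSpace (Icc t₁ t₂) := Subtype.preconnectedSpace isPreconnected_Icc
  let g : Icc t₁ t₂ → Prop := fun s => θ (s.1, z) ∈ D.region ε γ ℓl ℓu
  have hg : IsLocallyConstant g := by
    rw [IsLocallyConstant.iff_eventually_eq]
    rintro ⟨s, hs⟩
    by_cases hmem : θ (s, z) ∈ D.region ε γ ℓl ℓu
    · have hev := h.eventually_mem_region D hmem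
      have hev' : ∀ᶠ y : Icc t₁ t₂ in 𝓝 ⟨s, hs⟩, θ (y.1, z) ∈ D.region ε γ ℓl ℓu := by
        have := (continuous_subtype_val.continuousAt (x := (⟨s, hs⟩ : Icc t₁ t₂))).eventually hev
        filter_upwards [this] with y hy
        exact hy (hlev y.1 y.2)
      filter_upwards [hev'] with y hy
      exact propext ⟨fun _ => hmem, fun _ => hy⟩
    · have hopen : IsOpen ((D.region ε γ ℓl ℓu)ᶜ) := hN.isOpen_compl
      have hev : ∀ᶠ r in 𝓝 s, θ (r, z) ∉ D.region ε γ ℓl ℓu :=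
        (h.continuous_orbit z).continuousAt.eventually (hopen.mem_nhds hmem)
      have hev' : ∀ᶠ y : Icc t₁ t₂ in 𝓝 ⟨s, hs⟩, θ (y.1, z) ∉ D.region ε γ ℓl ℓu :=
        (continuous_subtype_val.continuousAt (x := (⟨s, hs⟩ : Icc t₁ t₂))).eventually hev
      filter_upwards [hev'] with y hy
      exact propext ⟨fun h' => absurd h' hy, fun h' => absurd h' hmem⟩
  have := hg.apply_eq_of_preconnectedSpace ⟨t, ht⟩ ⟨t', ht'⟩
  exact Iff.of_eq this

end Invariance

end Literature.Topology.FourManifolds
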